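import Mathlib
import Literature.Computability.AlgebraicComplexity.OrbitClosureWeights
import Literature.NumberTheory.DiophantineGeometry.GLHighestWeight

/-!
# Seed transfer: certifying explicit highest-weight vectors of `ℂ[Δ_m(f)]` and their algebraic
# independence by evaluation on explicit pencils (crux `ValuativeGCT.ValuativeFlip`,
# stmt-ValiantsHypothesis-12624; wall-breaker axis k13 "explicit padded-permanent highest-weight
# vectors for seedRichness")

The registered stub `stub_seedRichness` (line `big-cell-semigroup-floor`) asks for `D + 1`
ALGEBRAICALLY INDEPENDENT highest-weight vectors of one weight in the coordinate ring
`OrbitCoordRing (paddedPerFormLex ℂ n m) m = ℂ[Sym^m ℂ^{m²}] ⧸ I(GL · X₀₀^{m-n} per_n)`.  This file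
supplies the three transfer lemmas that turn EXPLICIT polynomials into such certified seeds, for the
orbit closure of ANY form `f`:

* `mk_mem_highestWeightSpace_orbitCoordRep` — an honest `B`-semi-invariant `F ∈ ℂ[Sym^m]`
  (`coordRep`) reduces to a highest-weight vector of `ℂ[Δ_m(f)]` (`orbitCoordRep`) of the same weight;
* `algebraicIndependent_mk_of_points` — the classes `[F_i]` are algebraically independent in
  `ℂ[Δ_m(f)]` as soon as their values `F_i(A(a) · f)` along an explicit family of (possibly SINGULAR)
  matrices `A(a)` are the values of algebraically independent polynomials `G_i(a)`: a relation among
  the classes lies in `I(GL · f) = ker (genericOrbitMap f m)` (the tree's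
  `orbitVanishingIdeal_eq_ker_genericOrbitMap`, Zariski density of `GL` in `Mat`), hence vanishes at
  every matrix, hence `P(G) = 0` pointwise, hence `P(G) = 0` (`MvPolynomial.funext`);
* `algebraicIndependent_of_det_pderiv_ne_zero` — the JACOBIAN CRITERION (sufficient half,
  characteristic zero): polynomials `G_i ∈ K[t_τ]` with a nonzero Jacobian minor
  `det (∂G_j/∂t_{a i})_{ij} ≠ 0` are algebraically independent (a relation `P(G) = 0` of minimal
  degree has a nonzero partial `∂_i P`, whose value `(∂_i P)(G)` is nonzero by minimality; the chain
  rule `∂_t P(G) = ∑_i (∂_i P)(G) ∂_t G_i` puts the nonzero vector `((∂_i P)(G))_i` in the kernel of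
  the Jacobian, contradicting `det ≠ 0` over the domain `K[t]`);
* `algebraicIndependent_monomial` — monomials with exponent vectors on which `c ↦ ∑ cᵢ Eᵢ` is
  injective, in algebraically independent elements, are algebraically independent (used to pass from
  independent seeds of several weights to independent seeds of ONE weight).

Sources: folklore (the Jacobian criterion, sufficient half: e.g. R. Ehrenborg, G.-C. Rota,
*Apolarity and canonical forms for homogeneous polynomials*, Europ. J. Combin. 14 (1993), Thm. 2.2;
Mulmuley–Sohoni, SIAM J. Comput. 31 (2001) §4 for `I(GL · f)` as the kernel of the orbit map).
-/

set_option linter.dupNamespace false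

namespace Summit.ValiantsHypothesis.ValiantsHypothesis.Theorems.ValuativeFlip

open MvPolynomial
open scoped BigOperators Matrix
open Literature.NumberTheory.DiophantineGeometry Literature.Computability.AlgebraicComplexity

noncomputable section

/-! ## The Jacobian criterion (sufficient half, characteristic zero) -/

section Jacobian

variable {K : Type*} [Field K] {ι τ : Type*}

/-- The total degree strictly drops under a partial derivative (when the derivative is nonzero).
[folklore] -/
theorem totalDegree_pderiv_lt [DecidableEq τ] (t : τ) {P : MvPolynomial τ K} (h : pderiv t P ≠ 0) :
    (pderiv t P).totalDegree < P.totalDegree := by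
  classical
  -- every monomial `s` of `∂_t P` comes from the monomial `s + ε_t` of `P`
  have hmon : ∀ s ∈ (pderiv t P).support, (s.sum fun _ e => e) + 1 ≤ P.totalDegree := by
    intro s hs
    have hc := mem_support_iff.mp hs
    rw [coeff_pderiv] at hc
    have hP : s + Finsupp.single t 1 ∈ P.support := mem_support_iff.mpr (left_ne_zero_of_mul hc)
    have hle := le_totalDegree hP
    rw [Finsupp.sum_add_index' (fun _ => rfl) (fun _ _ _ => rfl), Finsupp.sum_single_index rfl] at hle
    exact hle
  obtain ⟨s₀, hs₀⟩ := support_nonempty.mpr h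
  have hpos : 0 < P.totalDegree := lt_of_lt_of_le (Nat.succ_pos _) (hmon s₀ hs₀)
  rw [totalDegree, Finset.sup_lt_iff hpos]
  intro s hs
  exact Nat.lt_of_succ_le (hmon s hs)

/-- In characteristic zero a polynomial all of whose partial derivatives vanish is a constant.
[folklore] -/
theorem eq_C_of_forall_pderiv_eq_zero [CharZero K] [DecidableEq τ] (P : MvPolynomial τ K)
    (h : ∀ t, pderiv t P = 0) : P = C (coeff 0 P) := by
  classical
  ext s
  rw [coeff_C]
  by_cases hs : s = 0
  · subst hs
    rw [if_pos rfl]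
  · rw [if_neg (Ne.symm hs)]
    obtain ⟨t, ht⟩ := Finsupp.ne_iff.mp hs
    rw [Finsupp.zero_apply] at ht
    set s' : τ →₀ ℕ := s - Finsupp.single t 1 with hs'
    have hss : s' + Finsupp.single t 1 = s := by
      ext u
      simp only [hs', Finsupp.coe_add, Finsupp.coe_tsub, Pi.add_apply, Pi.sub_apply,
        Finsupp.single_apply]
      split_ifs with hu
      · subst hu; omega
      · omega
    have hc := congrArg (coeff s') (h t)
    rw [coeff_pderiv, coeff_zero, hss] at hc
    rcases mul_eq_zero.mp hc with h0 | h0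
    · exact h0
    · exact absurd h0 (Nat.cast_add_one_ne_zero _)

/-- **Chain rule** for partial derivatives through a substitution: for `G : ι → K[t_τ]` and
`P ∈ K[y_ι]`, `∂_t (P(G)) = ∑_i (∂_i P)(G) · ∂_t G_i`. [folklore] -/
theorem pderiv_aeval_eq_sum [Fintype ι] [DecidableEq ι] [DecidableEq τ] (G : ι → MvPolynomial τ K)
    (P : MvPolynomial ι K) (t : τ) :
    pderiv t (aeval G P) = ∑ i, aeval G (pderiv i P) * pderiv t (G i) := by
  induction P using MvPolynomial.induction_on with
  | C a =>
    simp only [aeval_C, algebraMap_eq, pderiv_C, map_zero, zero_mul, Finset.sum_const_zero]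
  | add p q hp hq =>
    simp only [map_add, hp, hq, add_mul, Finset.sum_add_distrib]
  | mul_X p j hp =>
    rw [map_mul, aeval_X, pderiv_mul, hp]
    have h1 : ∀ i, aeval G (pderiv i (p * X j)) * pderiv t (G i) =
        (aeval G (pderiv i p) * pderiv t (G i)) * G j +
          (if i = j then aeval G p * pderiv t (G j) else 0) := by
      intro i
      rw [pderiv_mul, pderiv_X, map_add, map_mul, map_mul, aeval_X]
      by_cases hij : i = j
      · subst hij
        simp only [Pi.single_eq_same, map_one, mul_one, if_true]
        ring
      · rw [Pi.single_eq_of_ne (Ne.symm hij), map_zero, mul_zero, add_zero, if_neg hij, add_zero]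
        ring
    simp only [h1, Finset.sum_add_distrib, Finset.sum_ite_eq', Finset.mem_univ, if_true,
      ← Finset.sum_mul]

/-- **Jacobian criterion for algebraic independence** (sufficient half, characteristic zero).  If
`G : ι → K[t_τ]` has a nonzero Jacobian minor — for some choice `a : ι → τ` of one variable per
polynomial, `det (∂ G_j / ∂ t_{a i})_{i,j} ≠ 0` in `K[t_τ]` — then `G` is algebraically independent
over `K`.  Proof: a nonzero relation `P(G) = 0` of minimal total degree has some `∂_i P ≠ 0`
(`eq_C_of_forall_pderiv_eq_zero`), and `(∂_i P)(G) ≠ 0` by minimality (`totalDegree_pderiv_lt`); the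
chain rule makes `v = ((∂_i P)(G))_i` a nonzero kernel vector of the Jacobian, so its determinant
vanishes (`Matrix.eq_zero_of_mulVec_eq_zero` over the domain `K[t]`). [folklore] -/
theorem algebraicIndependent_of_det_pderiv_ne_zero [CharZero K] [Fintype ι] [DecidableEq ι]
    [DecidableEq τ] (G : ι → MvPolynomial τ K) (a : ι → τ)
    (hdet : (Matrix.of fun i j => pderiv (a i) (G j)).det ≠ 0) :
    AlgebraicIndependent K G := by
  classical
  rw [algebraicIndependent_iff]
  by_contra hcon
  push Not at hcon
  have hex : ∃ d : ℕ, ∃ P : MvPolynomial ι K, aeval G P = 0 ∧ P ≠ 0 ∧ P.totalDegree = d := by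
    obtain ⟨P, hP, hP0⟩ := hcon
    exact ⟨_, P, hP, hP0, rfl⟩
  obtain ⟨P, hPG, hP0, hPd⟩ := Nat.find_spec hex
  have hmin : ∀ Q : MvPolynomial ι K, aeval G Q = 0 → Q ≠ 0 → P.totalDegree ≤ Q.totalDegree :=
    fun Q h1 h2 => hPd ▸ Nat.find_min' hex ⟨Q, h1, h2, rfl⟩
  -- some partial derivative of `P` is nonzero
  have hnc : ∃ i, pderiv i P ≠ 0 := by
    by_contra hall
    push Not at hall
    have hPC := eq_C_of_forall_pderiv_eq_zero P hall
    rw [hPC, aeval_C, algebraMap_eq, C_eq_zero] at hPG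
    rw [hPC, hPG, C_0] at hP0
    exact hP0 rfl
  -- the kernel vector `v`
  set v : ι → MvPolynomial τ K := fun i => aeval G (pderiv i P) with hv
  have hvne : v ≠ 0 := by
    obtain ⟨i, hi⟩ := hnc
    intro hv0
    have hvi : aeval G (pderiv i P) = 0 := congrFun hv0 i
    exact absurd (hmin _ hvi hi) (not_le.mpr (totalDegree_pderiv_lt i hi))
  have hMv : (Matrix.of fun i j => pderiv (a i) (G j)) *ᵥ v = 0 := by
    funext i
    rw [Matrix.mulVec, Pi.zero_apply]
    change ∑ j, pderiv (a i) (G j) * aeval G (pderiv j P) = 0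
    have h := pderiv_aeval_eq_sum G P (a i)
    rw [hPG, map_zero] at h
    rw [h]
    exact Finset.sum_congr rfl fun j _ => mul_comm _ _
  exact hvne (Matrix.eq_zero_of_mulVec_eq_zero hdet hMv)

end Jacobian

/-! ## Monomials in algebraically independent elements -/

section Monomials

variable {R A : Type*} [CommRing R] [CommRing A] [Algebra R A] {κ ι : Type*}

/-- The substitution `y_i ↦ x^{E i}` sends the monomial `y^c` to the monomial `x^{∑ cᵢ Eᵢ}`.
[folklore] -/
theorem aeval_monomial_monomial (E : ι → κ →₀ ℕ) (c : ι →₀ ℕ) (r : R) :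
    aeval (fun i => (monomial (E i) (1 : R) : MvPolynomial κ R)) (monomial c r) =
      monomial (c.sum fun i n => n • E i) r := by
  classical
  rw [aeval_monomial, algebraMap_eq]
  simp only [monomial_pow, one_pow]
  rw [Finsupp.prod, ← monomial_sum_one, C_mul_monomial, mul_one]
  rfl

/-- **Monomials in algebraically independent elements are algebraically independent** when the
exponent map `c ↦ ∑ cᵢ Eᵢ` is injective on `ι →₀ ℕ` (then distinct monomials in `y` go to distinct
monomials in `x`). [folklore] -/
theorem algebraicIndependent_monomial (x : κ → A) (hx : AlgebraicIndependent R x) (E : ι → κ →₀ ℕ)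
    (hE : Function.Injective fun c : ι →₀ ℕ => c.sum fun i n => n • E i) :
    AlgebraicIndependent R fun i => (E i).prod fun k n => x k ^ n := by
  classical
  -- the substitution `y_i ↦ x^{E i}` at the level of polynomials
  set θ : MvPolynomial ι R →ₐ[R] MvPolynomial κ R :=
    aeval fun i => (monomial (E i) (1 : R) : MvPolynomial κ R) with hθ
  have hfac : (aeval fun i => (E i).prod fun k n => x k ^ n : MvPolynomial ι R →ₐ[R] A) =
      (aeval x).comp θ := by
    refine MvPolynomial.algHom_ext fun i => ?_
    rw [aeval_X, AlgHom.comp_apply, hθ, aeval_X, aeval_monomial, map_one, one_mul]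
  -- `θ` moves the coefficient of `y^c` to the monomial `x^{∑ cᵢ Eᵢ}`, injectively
  set φ : (ι →₀ ℕ) → (κ →₀ ℕ) := fun c => c.sum fun i n => n • E i with hφ
  have hθsum : ∀ p : MvPolynomial ι R, θ p = ∑ c ∈ p.support, monomial (φ c) (coeff c p) := by
    intro p
    conv_lhs => rw [p.as_sum, map_sum]
    exact Finset.sum_congr rfl fun c _ => by rw [hθ, aeval_monomial_monomial]
  have hθcoeff : ∀ (p : MvPolynomial ι R) (c : ι →₀ ℕ), coeff (φ c) (θ p) = coeff c p := by
    intro p c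
    rw [hθsum, coeff_sum]
    simp only [coeff_monomial]
    rw [Finset.sum_eq_single c]
    · rw [if_pos rfl]
    · intro c' _ hc'
      rw [if_neg]
      exact fun h => hc' (hE h)
    · intro hc
      rw [if_pos rfl]
      exact notMem_support_iff.mp hc
  have hθinj : Function.Injective θ := by
    intro p q hpq
    ext c
    rw [← hθcoeff p c, ← hθcoeff q c, hpq]
  change Function.Injective (aeval fun i => (E i).prod fun k n => x k ^ n : MvPolynomial ι R →ₐ[R] A)
  rw [hfac, AlgHom.coe_comp]
  exact Function.Injective.comp hx hθinj

end Monomials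

/-! ## From `ℂ[Sym^m]` to the coordinate ring of an orbit closure -/

section Transfer

variable {σ : Type} [Fintype σ] [LinearOrder σ]

omit [Fintype σ] [LinearOrder σ] in
/-- Evaluation after substitution: `(P(G))(a) = P(G(a))`. [folklore] -/
theorem eval_aeval_eq_aeval {ι τ : Type*} (G : ι → MvPolynomial τ ℂ) (a : τ → ℂ)
    (Q : MvPolynomial ι ℂ) : eval a (aeval G Q) = aeval (fun i => eval a (G i)) Q := by
  rw [← aeval_eq_eval (f := a), aeval_eq_bind₁, aeval_bind₁]

/-- **Honest semi-invariants reduce to highest-weight vectors of `ℂ[Δ_m(f)]`.**  If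
`F ∈ ℂ[Sym^m ℂ^σ]` is a highest-weight vector of weight `χ` for `coordRep`, its class in
`OrbitCoordRing f m = ℂ[Sym^m] ⧸ I(GL · f)` is a highest-weight vector of weight `χ` for
`orbitCoordRep f m` (the quotient map is `GL`-equivariant, `orbitCoordSubst_mk`). [folklore] -/
theorem mk_mem_highestWeightSpace_orbitCoordRep (f : MvPolynomial σ ℂ) (m : ℕ) {χ : Weight σ}
    {F : MvPolynomial (DegIdx σ m) ℂ} (hF : F ∈ highestWeightSpace (coordRep σ ℂ m) χ) :
    (Ideal.Quotient.mk (orbitVanishingIdeal f m) F : OrbitCoordRing f m) ∈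
      highestWeightSpace (orbitCoordRep f m) χ := by
  intro g hg
  rw [orbitCoordRep_apply, orbitCoordSubst_mk, ← coordRep_apply, hF g hg]
  rw [← Ideal.Quotient.mkₐ_eq_mk ℂ, map_smul]

end Transfer

/-! ## Independence of classes by evaluation on explicit (possibly singular) matrix families -/

section Points

/-- **Algebraic independence in `ℂ[Δ_m(f)]` by evaluation on an explicit family of matrices.**
Let `F : ι → ℂ[Sym^m ℂ^σ]`, let `A : (τ → ℂ) → Mat_σ(ℂ)` be any family of (possibly singular)
matrices, and suppose the values `F_i(A(a) · f)` are the values `G_i(a)` of algebraically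
independent polynomials `G : ι → ℂ[t_τ]`.  Then the classes `[F_i] ∈ OrbitCoordRing f m` are
algebraically independent: a relation `P([F]) = 0` means `P(F) ∈ I(GL · f)`, which is the kernel of
the generic orbit map (`orbitVanishingIdeal_eq_ker_genericOrbitMap`, `GL` being Zariski dense in
`Mat`), so `P(F)(A · f) = 0` at EVERY matrix `A` (`eval_genericOrbitMap`), i.e. `P(G)(a) = 0` for all
`a`, i.e. `P(G) = 0` (`MvPolynomial.funext`), i.e. `P = 0`. [folklore] -/
theorem algebraicIndependent_mk_of_points {σ : Type} [Fintype σ] [LinearOrder σ]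
    (f : MvPolynomial σ ℂ) (m : ℕ) {ι τ : Type} (F : ι → MvPolynomial (DegIdx σ m) ℂ)
    (G : ι → MvPolynomial τ ℂ) (hG : AlgebraicIndependent ℂ G) (A : (τ → ℂ) → Matrix σ σ ℂ)
    (hA : ∀ (a : τ → ℂ) (i : ι), aeval (formCoeff m (linSubst σ ℂ (A a) f)) (F i) = eval a (G i)) :
    AlgebraicIndependent ℂ fun i => (Ideal.Quotient.mk (orbitVanishingIdeal f m) (F i) : OrbitCoordRing f m) := by
  classical
  rw [algebraicIndependent_iff]
  intro P hP
  -- `P(F) ∈ I(GL · f)`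
  have hPF : aeval F P ∈ orbitVanishingIdeal f m := by
    rw [← Ideal.Quotient.eq_zero_iff_mem, ← Ideal.Quotient.mkₐ_eq_mk ℂ, comp_aeval_apply]
    exact hP
  -- hence `genericOrbitMap (P(F)) = 0` and `P(F)` vanishes at every matrix
  rw [orbitVanishingIdeal_eq_ker_genericOrbitMap, RingHom.mem_ker] at hPF
  have hPF' : genericOrbitMap f m (aeval F P) = 0 := hPF
  have hpt : ∀ a : τ → ℂ, eval a (aeval G P) = 0 := by
    intro a
    have h1 := eval_genericOrbitMap f m (aeval F P) (A a)
    rw [hPF', map_zero, comp_aeval_apply] at h1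
    rw [eval_aeval_eq_aeval]
    have h2 : (fun i => eval a (G i)) = fun i => aeval (formCoeff m (linSubst σ ℂ (A a) f)) (F i) := by
      funext i
      rw [hA a i]
    rw [h2]
    exact h1.symm
  have hGP : aeval G P = 0 := MvPolynomial.funext fun a => by rw [hpt a, map_zero]
  exact (algebraicIndependent_iff.mp hG) P hGP

/-- Linear variant: classes `[F_i]` are LINEARLY independent in `ℂ[Δ_m(f)]` as soon as their values
along an explicit matrix family are linearly independent polynomials. [folklore] -/
theorem linearIndependent_mk_of_points {σ : Type} [Fintype σ] [LinearOrder σ]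
    (f : MvPolynomial σ ℂ) (m : ℕ) {ι τ : Type} (F : ι → MvPolynomial (DegIdx σ m) ℂ)
    (G : ι → MvPolynomial τ ℂ) (hG : LinearIndependent ℂ G) (A : (τ → ℂ) → Matrix σ σ ℂ)
    (hA : ∀ (a : τ → ℂ) (i : ι), aeval (formCoeff m (linSubst σ ℂ (A a) f)) (F i) = eval a (G i)) :
    LinearIndependent ℂ fun i => (Ideal.Quotient.mk (orbitVanishingIdeal f m) (F i) : OrbitCoordRing f m) := by
  classical
  rw [linearIndependent_iff']
  intro s c hc i hi
  -- the combination `∑ c_i F_i` lies in the ideal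
  have hmem : ∑ j ∈ s, c j • F j ∈ orbitVanishingIdeal f m := by
    rw [← Ideal.Quotient.eq_zero_iff_mem, ← Ideal.Quotient.mkₐ_eq_mk ℂ, map_sum]
    simp only [map_smul, Ideal.Quotient.mkₐ_eq_mk]
    exact hc
  rw [orbitVanishingIdeal_eq_ker_genericOrbitMap, RingHom.mem_ker] at hmem
  have hmem' : genericOrbitMap f m (∑ j ∈ s, c j • F j) = 0 := hmem
  have hpt : ∀ a : τ → ℂ, eval a (∑ j ∈ s, c j • G j) = 0 := by
    intro a
    have h1 := eval_genericOrbitMap f m (∑ j ∈ s, c j • F j) (A a)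
    rw [hmem', map_zero, map_sum] at h1
    rw [map_sum]
    have h2 : ∀ j ∈ s, eval a (c j • G j) =
        aeval (formCoeff m (linSubst σ ℂ (A a) f)) (c j • F j) := by
      intro j _
      rw [smul_eval, map_smul, hA a j, smul_eq_mul]
    rw [Finset.sum_congr rfl h2]
    exact h1.symm
  have hG0 : ∑ j ∈ s, c j • G j = 0 := MvPolynomial.funext fun a => by rw [hpt a, map_zero]
  exact (linearIndependent_iff'.mp hG) s c hG0 i hi

end Points

end

end Summit.ValiantsHypothesis.ValiantsHypothesis.Theorems.ValuativeFlip
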